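import Mathlib
import Literature.AlgebraicGeometry.Resolution.TranscendenceDefect
import Literature.AlgebraicGeometry.Resolution.TranscendentallyImmediate
import Literature.AlgebraicGeometry.Resolution.AbhyankarBases
import Literature.AlgebraicGeometry.Resolution.GeneralizedStability
import Literature.AlgebraicGeometry.Resolution.GeneralizedStabilityHolds
import Literature.AlgebraicGeometry.Resolution.DefectTransport
import Literature.AlgebraicGeometry.Resolution.Kuhlmann2019HenselianRationalitySteps
import Summits.ResolutionOfSingularities.ResolutionOfSingularities.Theorems.DefectlessFramesDefectlessFramesRDefectTail

/-!
# Abhyankar places: defectlessness of `K/k(y')` (stub `stub_dfrAbhyankar`)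

Crux `DefectlessFramesR`, line `Sketch`. Let `k` be perfect of characteristic `p`, `K/k` finitely
generated, `O ⊇ k` a valuation ring of `K`, and `(y'; z')` a frame: `y' : Fin n → O` algebraically
independent over `k`, `z' ∈ O` integral and separable over `k(y')`, `K = k(y', z')`. If `O` is an
**Abhyankar** place (transcendence defect `D(O) = 0`), then for every algebraic closure `Ω ⊇ K` and
valuation ring `V` of `Ω` over `O`, with `F` the image of `k(y')` in `Ω` and `F^h` its henselization,
`F^h · K = F^h(z')` is a defectless extension of `F^h`.

* `dfrAbh_ratRank_le_ratRank_comap`, `dfrAbh_residueTrdeg_eq_residueTrdeg_comap`,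
  `dfrAbh_transcendenceDefect_comap_eq_zero` — **`D = 0` descends along a finite extension of valued
  fields** `K₁ ⊇ K ⊇ k`: the value group of `K` has finite index in that of `K₁` (so the rational
  ranks agree, value groups being torsion-free) and the residue field of `K₁` is finite over that of
  `K` (so the residue transcendence degrees agree), while `tr.deg` does not change.
* `dfrAbh_isDefectlessField_adjoin` — hence `k(y')` with `O ∩ k(y')` is Abhyankar, so a defectless
  field by the **generalized stability theorem** (`Kuhlmann2010Stability_holds`).
* `stub_dfrAbhyankar` — transport to `F ≅ k(y')` (`IsDefectlessField.congr`), weaken to separably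
  defectless, and conclude by the shared tail `stub_dfrDefectTail`.
-/

namespace Summit.ResolutionOfSingularities.ResolutionOfSingularities.Theorems

open IsLocalRing Literature.AlgebraicGeometry.Resolution

universe u

/-- **`E` does not drop under restriction to a subfield of finite codimension**: for `K₁ ⊇ K`
finite and a valuation ring `O₁` of `K₁`, `E(O₁) ≤ E(O₁ ∩ K)`. The value group `vK` has finite
index `n` in `vK₁` (`ramificationIndex_mul_inertiaDegree_le_finrank`), and `γ ↦ n·γ` embeds the
torsion-free `vK₁` into `vK`. [folklore] -/
theorem dfrAbh_ratRank_le_ratRank_comap {K K₁ : Type u} [Field K] [Field K₁] [Algebra K K₁]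
    [FiniteDimensional K K₁] (O₁ : ValuationSubring K₁) :
    ratRank O₁ ≤ ratRank (O₁.comap (algebraMap K K₁)) := by
  obtain ⟨hfi, -, -⟩ := ramificationIndex_mul_inertiaDegree_le_finrank K O₁
  let φ : Additive (ValuationSubring.ValueGroup (O₁.comap (algebraMap K K₁)))ˣ →ₗ[ℤ]
      Additive (ValuationSubring.ValueGroup O₁)ˣ :=
    (MonoidHom.toAdditive (unitsValueGroupHom K O₁)).toIntLinearMap
  have hφapply : ∀ a, φ a = Additive.ofMul (unitsValueGroupHom K O₁ (Additive.toMul a)) :=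
    fun _ => rfl
  have hφinj : Function.Injective φ := fun a b h => by
    rw [hφapply, hφapply] at h
    exact Additive.toMul.injective (unitsValueGroupHom_injective K O₁ (Additive.ofMul.injective h))
  set n : ℕ := (valueSubgroup K O₁).index with hn
  have hn0 : n ≠ 0 := hfi.index_ne_zero
  have hmem : ∀ g : Additive (ValuationSubring.ValueGroup O₁)ˣ,
      DistribSMul.toLinearMap ℤ _ n g ∈ LinearMap.range φ := by
    intro g
    have h1 : (Additive.toMul g) ^ n ∈ valueSubgroup K O₁ := Subgroup.pow_index_mem _ _
    rw [← range_unitsValueGroupHom] at h1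
    obtain ⟨u, hu⟩ := h1
    refine ⟨Additive.ofMul u, ?_⟩
    rw [hφapply, DistribSMul.toLinearMap_apply, toMul_ofMul, hu, ofMul_pow, ofMul_toMul]
  let ψ : Additive (ValuationSubring.ValueGroup O₁)ˣ →ₗ[ℤ]
      Additive (ValuationSubring.ValueGroup (O₁.comap (algebraMap K K₁)))ˣ :=
    (LinearEquiv.ofInjective φ hφinj).symm.toLinearMap ∘ₗ
      ((DistribSMul.toLinearMap ℤ _ n).codRestrict (LinearMap.range φ) hmem)
  have hψ : Function.Injective ψ := by
    intro a b h
    have h' := (LinearEquiv.ofInjective φ hφinj).symm.injective h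
    exact AddSubgroup.distribSMulToLinearMap_injective_of_isTorsionFree
      (M := Additive (ValuationSubring.ValueGroup O₁)ˣ) hn0 (congrArg Subtype.val h')
  exact LinearMap.rank_le_of_injective ψ hψ

/-- **`F` does not change under restriction to a subfield of finite codimension**: for
`K₁ ⊇ K ⊇ k` with `K₁/K` finite and `k ⊆ O₁`, the residue field of `O₁` is algebraic (finite) over
that of `O₁ ∩ K` (`ramificationIndex_mul_inertiaDegree_le_finrank`), so both have the same
transcendence degree over `k`. [folklore] -/
theorem dfrAbh_residueTrdeg_eq_residueTrdeg_comap {k K K₁ : Type u} [Field k] [Field K] [Field K₁]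
    [Algebra k K] [Algebra K K₁] [Algebra k K₁] [IsScalarTower k K K₁] [FiniteDimensional K K₁]
    (O₁ : ValuationSubring K₁) (hk₁ : ∀ c : k, algebraMap k K₁ c ∈ O₁) :
    residueTrdeg k O₁ hk₁ =
      residueTrdeg k (O₁.comap (algebraMap K K₁)) (algebraMap_mem_comap_of_mem O₁ hk₁) := by
  obtain ⟨-, hfin, -⟩ := ramificationIndex_mul_inertiaDegree_le_finrank K O₁
  set O := O₁.comap (algebraMap K K₁) with hO
  have hk : ∀ c : k, algebraMap k K c ∈ O := algebraMap_mem_comap_of_mem O₁ hk₁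
  letI := algebraOfMem k O₁ hk₁
  letI := algebraOfMem k O hk
  let χ := residueFieldComapAlgHom k O₁ hk₁ hk
  letI : Algebra (ResidueField O) (ResidueField O₁) := χ.toRingHom.toAlgebra
  haveI : IsScalarTower k (ResidueField O) (ResidueField O₁) :=
    IsScalarTower.of_algebraMap_eq fun c => (χ.commutes c).symm
  -- `K̃₁` is algebraic over `K̃`
  haveI : Module.Finite (residueSubfield K O₁) (ResidueField O₁) := hfin
  have hχ : ∀ x : O, χ (residue O x) = residue O₁ (comapInclusion O₁ x) := fun x =>
    ResidueField.map_residue _ _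
  let f : ResidueField O →+* residueSubfield K O₁ :=
    χ.toRingHom.codRestrict (residueSubfield K O₁) fun r => by
      obtain ⟨x, rfl⟩ := residue_surjective r
      rw [AlgHom.toRingHom_eq_coe, AlgHom.coe_toRingHom, hχ]
      exact (mem_residueSubfield_iff K O₁ _).mpr ⟨x, x.2, rfl⟩
  have hf : Function.Surjective f := by
    rintro ⟨r, hr⟩
    obtain ⟨c, hc, rfl⟩ := (mem_residueSubfield_iff K O₁ r).mp hr
    exact ⟨residue O ⟨c, hc⟩, Subtype.ext (hχ ⟨c, hc⟩)⟩
  haveI : Algebra.IsAlgebraic (ResidueField O) (ResidueField O₁) :=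
    Algebra.IsAlgebraic.of_ringHom_of_comp_eq f (RingHom.id (ResidueField O₁)) hf
      Function.injective_id (RingHom.ext fun _ => rfl)
  have h := trdeg_add_eq k (ResidueField O) (A := ResidueField O₁)
  rw [trdeg_eq_zero (R := ResidueField O) (A := ResidueField O₁), add_zero] at h
  exact h.symm

/-- **`D = 0` descends along a finite extension of valued fields.** For `K/k` finitely generated,
`K₁ ⊇ K` finite, `k ⊆ O₁`: if `D(O₁) = 0` then `D(O₁ ∩ K) = 0`. Indeed `E + F = tr.deg` for `O₁`,
`E` and `F` do not drop under restriction to `K` (`dfrAbh_ratRank_le_ratRank_comap`,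
`dfrAbh_residueTrdeg_eq_residueTrdeg_comap`), `tr.deg_k K₁ = tr.deg_k K`, and `E + F ≤ tr.deg`
for `O₁ ∩ K` (Abhyankar's inequality). [folklore] -/
theorem dfrAbh_transcendenceDefect_comap_eq_zero {k K K₁ : Type u} [Field k] [Field K] [Field K₁]
    [Algebra k K] [Algebra K K₁] [Algebra k K₁] [IsScalarTower k K K₁] [FiniteDimensional K K₁]
    (O₁ : ValuationSubring K₁) (hk₁ : ∀ c : k, algebraMap k K₁ c ∈ O₁)
    (hfg : (⊤ : IntermediateField k K).FG) (hD₁ : transcendenceDefect k O₁ hk₁ = 0) :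
    transcendenceDefect k (O₁.comap (algebraMap K K₁)) (algebraMap_mem_comap_of_mem O₁ hk₁) = 0 := by
  set O := O₁.comap (algebraMap K K₁) with hO
  have hk : ∀ c : k, algebraMap k K c ∈ O := algebraMap_mem_comap_of_mem O₁ hk₁
  have hN : Algebra.trdeg k K < Cardinal.aleph0 := trdeg_lt_aleph0_of_fg hfg
  have htr : Algebra.trdeg k K₁ = Algebra.trdeg k K := by
    have h := trdeg_add_eq k K (A := K₁)
    rw [trdeg_eq_zero (R := K) (A := K₁), add_zero] at h
    exact h.symm
  have hN₁ : Algebra.trdeg k K₁ < Cardinal.aleph0 := htr ▸ hN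
  have hsum := (transcendenceDefect_eq_zero_iff O₁ hk₁ hN₁).mp hD₁
  refine (transcendenceDefect_eq_zero_iff O hk hN).mpr
    (le_antisymm (ratRank_add_residueTrdeg_le_trdeg O hk) ?_)
  rw [← htr, ← hsum, dfrAbh_residueTrdeg_eq_residueTrdeg_comap (K := K) O₁ hk₁]
  exact add_le_add (dfrAbh_ratRank_le_ratRank_comap O₁) le_rfl

/-- **Projections of Abhyankar places are defectless.** For `K/k` finitely generated with `k ⊆ O`,
`D(O) = 0`, and an intermediate field `F'` finitely generated over `k` with `K/F'` finite:
`(F', O ∩ F')` is a defectless field — `D(O ∩ F') = 0` (`dfrAbh_transcendenceDefect_comap_eq_zero`)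
and the generalized stability theorem (`Kuhlmann2010Stability_holds`). [folklore] -/
theorem dfrAbh_isDefectlessField_adjoin {k K : Type} [Field k] [Field K] [Algebra k K]
    (O : ValuationSubring K) (hk : ∀ c : k, algebraMap k K c ∈ O) (hD : transcendenceDefect k O hk = 0)
    (F' : IntermediateField k K) [FiniteDimensional F' K] (hfgF' : (⊤ : IntermediateField k F').FG) :
    IsDefectlessField F' (O.comap (algebraMap F' K)) :=
  Kuhlmann2010Stability_holds k F' hfgF' (O.comap (algebraMap F' K))
    (algebraMap_mem_comap_of_mem O hk)
    (dfrAbh_transcendenceDefect_comap_eq_zero (K := F') (K₁ := K) O hk hfgF' hD)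

/-- **Abhyankar places give defectless projections** (stub `stub_dfrAbhyankar` of crux
`DefectlessFramesR`, line `Sketch`). For `k` perfect, `K/k` finitely generated, `O ⊇ k` a valuation
ring of `K` with transcendence defect `0`, and a frame `(y'; z')` (`y'` algebraically independent,
`z'` separable over `k(y')`, `K = k(y', z')`): for every algebraic closure `Ω ⊇ K` and valuation ring
`V` over `O`, with `F` the image of `k(y')` in `Ω` and `F^h` its henselization, `F^h · K` is a
defectless extension of `F^h`. Proof: `k(y')` with `O ∩ k(y')` is Abhyankar (`D = 0` descends along
the finite `K/k(y')`), hence a defectless field by Kuhlmann's generalized stability theorem; transport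
to `F ≅ k(y')`, and over the henselian, separably defectless `F^h` the finite separable extension
`F^h(z')` satisfies `[F^h(z') : F^h] = e·f` (`stub_dfrDefectTail`). [folklore] -/
theorem stub_dfrAbhyankar : ∀ p : ℕ, p.Prime → ∀ (k K : Type) [Field k] [CharP k p] [PerfectField k] [Field K] [Algebra k K], (⊤ : IntermediateField k K).FG → ∀ O : ValuationSubring K, ∀ hk : (∀ c : k, algebraMap k K c ∈ O), Nonempty O.valuation.RankOne → (∀ x ∈ O, ∃ f : Polynomial k, f ≠ 0 ∧ Polynomial.aeval x f ∈ O.nonunits) → Literature.AlgebraicGeometry.Resolution.transcendenceDefect k O hk = 0 → ∀ (n : ℕ) (y' : Fin n → O) (z' : O), AlgebraicIndependent k (fun i => (y' i : K)) → IsIntegral (Algebra.adjoin k (Set.range fun i => (y' i : K))) (z' : K) → IntermediateField.adjoin k (Set.range (fun i => (y' i : K)) ∪ {(z' : K)}) = ⊤ → IsSeparable (IntermediateField.adjoin k (Set.range fun i => (y' i : K))) (z' : K) → ∀ (Ω : Type) [Field Ω] [Algebra K Ω] [IsAlgClosure K Ω] (V : ValuationSubring Ω), V.comap (algebraMap K Ω)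 = O → let F : Subfield Ω := (IntermediateField.adjoin k (Set.range fun i => (y' i : K))).toSubfield.map (algebraMap K Ω); Literature.AlgebraicGeometry.Resolution.IsDefectlessExtension V (Literature.AlgebraicGeometry.Resolution.henselization V F) (Literature.AlgebraicGeometry.Resolution.henselization V F ⊔ (algebraMap K Ω).fieldRange) := by
  intro p _hp k K _ _ _ _ _ _hfg O hk _hR _hZ hD n y' z' _hy _hint hadj hsep Ω _ _ _ V hVO F
  haveI : IsAlgClosed Ω := IsAlgClosure.isAlgClosed K
  subst hVO
  refine stub_dfrDefectTail k K n (fun i => (y' i : K)) (z' : K) hadj hsep Ω V ?_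
  set F' : IntermediateField k K := IntermediateField.adjoin k (Set.range fun i => (y' i : K)) with hF'
  -- `K = F'(z')` is finite over `F'`, and `F'` is finitely generated over `k`
  have htop : IntermediateField.adjoin F' ({(z' : K)} : Set K) = ⊤ := by
    apply IntermediateField.restrictScalars_injective k
    rw [IntermediateField.restrictScalars_top, IntermediateField.restrictScalars_adjoin,
      ← hadj, hF']
    exact le_antisymm (IntermediateField.adjoin_le_iff.mpr (Set.union_subset
        (fun x hx => IntermediateField.adjoin.mono k _ _ Set.subset_union_left hx)
        (fun x hx => IntermediateField.subset_adjoin k _ (Or.inr hx))))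
      (IntermediateField.adjoin.mono k _ _ (Set.union_subset_union_left _
        (IntermediateField.subset_adjoin k _)))
  haveI : FiniteDimensional F' K := by
    haveI : FiniteDimensional F' (IntermediateField.adjoin F' ({(z' : K)} : Set K)) :=
      IntermediateField.adjoin.finiteDimensional hsep.isIntegral
    rw [htop] at this
    exact IntermediateField.topEquiv.toLinearEquiv.finiteDimensional
  have hfgF' : (⊤ : IntermediateField k F').FG :=
    IntermediateField.fg_top_iff.mpr
      (IntermediateField.essFiniteType_iff.mpr (IntermediateField.fg_adjoin_of_finite (Set.finite_range _)))
  -- `(F', O ∩ F')` is a defectless field (generalized stability)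
  have hdef : IsDefectlessField F' ((V.comap (algebraMap K Ω)).comap (algebraMap F' K)) :=
    dfrAbh_isDefectlessField_adjoin (V.comap (algebraMap K Ω)) hk hD F' hfgF'
  -- transport along `F' ≃ F`
  have hFmem : ∀ x ∈ F', algebraMap K Ω x ∈ F := fun x hx => Subfield.mem_map.mpr ⟨x, hx, rfl⟩
  let f : F' →+* F := ((algebraMap K Ω).comp (algebraMap F' K)).codRestrict F fun x => hFmem x x.2
  have hfs : Function.Surjective f := by
    rintro ⟨x, hx⟩
    obtain ⟨w, hw, rfl⟩ := Subfield.mem_map.mp hx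
    exact ⟨⟨w, hw⟩, rfl⟩
  let e : F' ≃+* F := RingEquiv.ofBijective f ⟨f.injective, hfs⟩
  have hO : (V.comap (algebraMap K Ω)).comap (algebraMap F' K) =
      (V.comap (algebraMap F Ω)).comap e.toRingHom := by
    ext x
    rfl
  exact (IsDefectlessField.congr e hO hdef).isSeparablyDefectlessField

end Summit.ResolutionOfSingularities.ResolutionOfSingularities.Theorems
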